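import Literature.Geometry.Lorentzian.CarterConeRate
import Literature.Geometry.Lorentzian.CarterHorizonZone
import Literature.Analysis.ODE.SoninFromInfinity
import HarnessLib

/-!
# The cap of Carter's coefficient is monotone in the superradiant Breitenlohner–Freedman-stable regime,
# and the resulting SHARP cap bounds `φ|u_𝓗|² + |u_𝓗′|² ≤ 2σ²`
(namespace `Literature.Geometry.Lorentzian.Kerr`.)

Carter's radial equation `u″ + φu = 0`, `φ = ω² − V∘ρ` (`V = Kerr.sepPotential M a ω m Λ`, `ρ` a tortoise
radius; DRSR arXiv:1402.7034 §5.2.3) on a sub-extremal Kerr exterior, at a SUPERRADIANT frequency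
(`ωσ < 0`, `σ := ω − mω₊`) in a BF-STABLE sector with margin `(1 + θ₁)(2r₊ω)² ≤ Λ′ := Λ − 2amω`,
`0 < θ₁ ≤ 1`, `Λ′ ≥ 100`. On the CAP — the classically allowed region `V ≤ ω²` adjacent to the horizon,
within `r ≤ r₊(1 + θ₁/8)` — the potential is NON-DECREASING in `r`, hence `φ` is non-increasing in the
tortoise variable, and the Sonin–Pólya energy of the horizon-normalised solution is bounded by its limit
`2σ²` (`Literature.Analysis.ODE.soninEnergy_le_two_mul_sq_of_horizon_data`): `|u_𝓗′|² ≤ 2σ²`,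
`φ|u_𝓗|² ≤ 2σ²` on the whole cap — with NO loss in `Λ` or in the surface gravity `κ`. Mechanism
(`F := (r²+a²)²(ω² − V) = K² − ΔΛ′ − (r²+a²)²V₁`, `Kerr.sq_mul_coeff_eq`):

* `radialK_mul_lt_zero_of_cap` — on the cap `Kω < 0`: otherwise `K² ≤ ω²(r − r₊)²(r + r₊)² ≤ Δω²(r + r₊)²`
  (`Kerr.sq_omega_mul_eq_delta_mul`) `< ΔΛ′ ≤ K²` by the margin; this is where SUPERRADIANCE enters
  (`K = (r₊²+a²)σ + ω(r − r₊)(r + r₊)` with `σω < 0`);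
* `critPoly₁_eq_add_delta_mul`, `critPoly₁_ge_neg` — `P₁ = (r²+a²)⁵V₁′ = 2(r − M)(r²+a²)(a²Δ + 2Mr(r² − a²))
  + Δ·(−10Mr⁴ − 6a²r³ + 34Ma²r² − 6a⁴r − 4Ma⁴) ≥ −344ΔM⁵` on `[M, 9M/4]`;
* `deriv_sepPotential_nonneg_of_cap` — `dV/dr ≥ 0` on the cap: comparing the two expressions of `F′`
  (`HasDerivAt.unique`), `(r²+a²)²V′ = 4r(r²+a²)(ω² − V) − 4rKω + 2(r − M)Λ′ + [(r²+a²)²V₁]′ ≥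
  (r − r₋)(Λ′ − 86) > 0` (`2(r − M) = (r − r₊) + (r − r₋)`, `r − r₊ ≤ M/4`);
* `carter_cap_soninEnergy_le` — for the `𝓗⁺`-data solution along a tortoise radius and any `b` with
  `φ ≥ 0` on `(−∞, b]`, `ρ b ≤ r₊(1 + θ₁/8)`: `φ(s)‖u s‖² + ‖u′ s‖² ≤ 2σ²` for all `s ≤ b`.

Pure algebra + one derivative comparison; all proved. This is the sharp cap input (`P₁² ≤ 2σ²`) making the
depth condition of the deep-barrier kernel bound κ-uniform (near-extremal Kerr programme, stub
`stub_coneKernelLargeStableSuperradiantPoly`).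

## References
* M. Dafermos, I. Rodnianski, Y. Shlapentokh-Rothman, arXiv:1402.7034 = Ann. of Math. 183 (2016),
  §§5.2.3, 6.2–6.3 (key `DafermosRodnianskiShlapentokhrothman2014`).
* G. Szegő, *Orthogonal Polynomials*, 4th ed. (1975), Thm 7.31.1 (Sonin–Pólya). The assembly is folklore.
-/

noncomputable section

open Set Filter Literature.Analysis.ODE
open scoped _root_.Topology

namespace Literature.Geometry.Lorentzian

namespace Kerr

section Algebra

variable {M a ω Λ : ℝ} {m : ℤ}

/-- **`P₁ = (r² + a²)⁵ V₁′` split off its `Δ′`-part**: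
`P₁ = 2(r − M)(r² + a²)(a²Δ + 2Mr(r² − a²)) + Δ·(−10Mr⁴ − 6a²r³ + 34Ma²r² − 6a⁴r − 4Ma⁴)`. [folklore] -/
theorem critPoly₁_eq_add_delta_mul (M a r : ℝ) :
    critPoly₁ M a r = 2 * (r - M) * (r ^ 2 + a ^ 2) * (a ^ 2 * delta M a r + 2 * M * r * (r ^ 2 - a ^ 2)) +
      delta M a r * (-10 * M * r ^ 4 - 6 * a ^ 2 * r ^ 3 + 34 * M * a ^ 2 * r ^ 2 - 6 * a ^ 4 * r -
        4 * M * a ^ 4) := by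
  unfold critPoly₁ delta
  ring

/-- **`P₁ ≥ −344 Δ M⁵` on `[M, 9M/4]`** (`|a| ≤ M`, `Δ ≥ 0`): the `Δ′`-part is non-negative there.
[folklore] -/
theorem critPoly₁_ge_neg {M a r : ℝ} (hM : 0 < M) (haM : |a| ≤ M) (hr1 : M ≤ r) (hr2 : r ≤ 9 * M / 4)
    (hΔ : 0 ≤ delta M a r) : -(344 * M ^ 5) * delta M a r ≤ critPoly₁ M a r := by
  rw [critPoly₁_eq_add_delta_mul]
  have hr0 : 0 ≤ r := hM.le.trans hr1
  have ha2 : a ^ 2 ≤ M ^ 2 := by rw [← sq_abs]; exact pow_le_pow_left₀ (abs_nonneg a) haM 2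
  have ha2r : a ^ 2 ≤ r ^ 2 := ha2.trans (pow_le_pow_left₀ hM.le hr1 2)
  have ha0 : 0 ≤ a ^ 2 := sq_nonneg a
  -- the `Δ′`-part is non-negative
  have h1 : 0 ≤ 2 * (r - M) * (r ^ 2 + a ^ 2) * (a ^ 2 * delta M a r + 2 * M * r * (r ^ 2 - a ^ 2)) := by
    have : 0 ≤ a ^ 2 * delta M a r + 2 * M * r * (r ^ 2 - a ^ 2) := by
      have := mul_nonneg ha0 hΔ
      have : 0 ≤ 2 * M * r * (r ^ 2 - a ^ 2) := by
        apply mul_nonneg (by positivity); linarith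
      linarith
    apply mul_nonneg (mul_nonneg (by linarith) (by positivity)) this
  -- the `Δ`-part: `H ≥ −344 M⁵`
  have hr4 : r ^ 4 ≤ (9 * M / 4) ^ 4 := pow_le_pow_left₀ hr0 hr2 4
  have hr3 : r ^ 3 ≤ (9 * M / 4) ^ 3 := pow_le_pow_left₀ hr0 hr2 3
  have ha4 : a ^ 4 ≤ M ^ 4 := by
    have := pow_le_pow_left₀ ha0 ha2 2
    have e1 : (a ^ 2) ^ 2 = a ^ 4 := by ring
    have e2 : (M ^ 2) ^ 2 = M ^ 4 := by ring
    rwa [e1, e2] at this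
  have t1 : 10 * M * r ^ 4 ≤ 257 * M ^ 5 := by
    calc 10 * M * r ^ 4 ≤ 10 * M * (9 * M / 4) ^ 4 := by gcongr
      _ = 65610 / 256 * M ^ 5 := by ring
      _ ≤ 257 * M ^ 5 := by nlinarith [pow_pos hM 5]
  have t2 : 6 * a ^ 2 * r ^ 3 ≤ 69 * M ^ 5 := by
    calc 6 * a ^ 2 * r ^ 3 ≤ 6 * M ^ 2 * (9 * M / 4) ^ 3 := by gcongr
      _ = 4374 / 64 * M ^ 5 := by ring
      _ ≤ 69 * M ^ 5 := by nlinarith [pow_pos hM 5]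
  have t3 : 6 * a ^ 4 * r ≤ 14 * M ^ 5 := by
    calc 6 * a ^ 4 * r ≤ 6 * M ^ 4 * (9 * M / 4) := by gcongr
      _ = 27 / 2 * M ^ 5 := by ring
      _ ≤ 14 * M ^ 5 := by nlinarith [pow_pos hM 5]
  have t4 : 4 * M * a ^ 4 ≤ 4 * M ^ 5 := by
    calc 4 * M * a ^ 4 ≤ 4 * M * M ^ 4 := by gcongr
      _ = 4 * M ^ 5 := by ring
  have t5 : 0 ≤ 34 * M * a ^ 2 * r ^ 2 := by positivity
  have hH : -(344 * M ^ 5) ≤ -10 * M * r ^ 4 - 6 * a ^ 2 * r ^ 3 + 34 * M * a ^ 2 * r ^ 2 -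
      6 * a ^ 4 * r - 4 * M * a ^ 4 := by linarith
  have h2 := mul_le_mul_of_nonneg_left hH hΔ
  linarith

/-- **On the cap, `Kω < 0`.** For `|a| < M`, `0 < θ₁ ≤ 1`, the margin `(1 + θ₁)(2r₊ω)² ≤ Λ′`, a
superradiant frequency `ωσ < 0` (`σ = ω − mω₊`), and `r₊ < r ≤ r₊(1 + θ₁/8)` with `V(r) ≤ ω²`:
`K(r)·ω < 0`, `K = ω(r² + a²) − am`. [folklore] -/
theorem radialK_mul_lt_zero_of_cap (ha : |a| < M) {θ₁ : ℝ} (hθ₁ : 0 < θ₁) (hθ₁1 : θ₁ ≤ 1)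
    (hmargin : (1 + θ₁) * (2 * rPlus M a * ω) ^ 2 ≤ Λ - 2 * a * m * ω)
    (hωσ : ω * (ω - m * horizonAngularVelocity M a) < 0)
    {r : ℝ} (hr : rPlus M a < r) (hr2 : r ≤ rPlus M a * (1 + θ₁ / 8))
    (hcap : sepPotential M a ω m Λ r ≤ ω ^ 2) :
    radialK a ω m r * ω < 0 := by
  have hM : 0 < M := lt_of_le_of_lt (abs_nonneg a) ha
  have haM : |a| ≤ M := ha.le
  set rp := rPlus M a with hrp
  set Λ' := Λ - 2 * a * m * ω with hΛ'
  set σ := ω - m * horizonAngularVelocity M a with hσdef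
  set K := radialK a ω m r with hK
  have hrp0 : 0 < rp := rPlus_pos hM a
  have hr0 : 0 < r := hrp0.trans hr
  have hA : r ^ 2 + a ^ 2 ≠ 0 := by positivity
  have hω0 : ω ≠ 0 := fun e ↦ by rw [e, zero_mul] at hωσ; exact lt_irrefl _ hωσ
  have hω2 : 0 < ω ^ 2 := by positivity
  have hΔ : 0 < delta M a r := delta_pos haM hr
  -- `K² ≥ ΔΛ′` on the cap
  have hF := sq_mul_coeff_eq M a ω m Λ hA
  have hV₁ : 0 ≤ (r ^ 2 + a ^ 2) ^ 2 * sepPotential₁ M a r :=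
    mul_nonneg (sq_nonneg _) (sepPotential₁_nonneg haM hr.le)
  have hF0 : 0 ≤ (r ^ 2 + a ^ 2) ^ 2 * (ω ^ 2 - sepPotential M a ω m Λ r) :=
    mul_nonneg (sq_nonneg _) (by linarith)
  have hK2 : delta M a r * Λ' ≤ K ^ 2 := by rw [hK]; linarith
  -- `ω²(r + rp)² < Λ′` by the margin
  have hωΛ : ω ^ 2 * (r + rp) ^ 2 < Λ' := by
    have h1 : (r + rp) ^ 2 ≤ (2 + θ₁ / 8) ^ 2 * rp ^ 2 := by
      have h2 : r + rp ≤ (2 + θ₁ / 8) * rp := by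
        have e : (2 + θ₁ / 8) * rp = rp * (1 + θ₁ / 8) + rp := by ring
        linarith
      calc (r + rp) ^ 2 ≤ ((2 + θ₁ / 8) * rp) ^ 2 := pow_le_pow_left₀ (by positivity) h2 2
        _ = (2 + θ₁ / 8) ^ 2 * rp ^ 2 := by ring
    have hω : 4 * (1 + θ₁) * (ω ^ 2 * rp ^ 2) ≤ Λ' := by
      calc 4 * (1 + θ₁) * (ω ^ 2 * rp ^ 2) = (1 + θ₁) * (2 * rp * ω) ^ 2 := by ring
        _ ≤ Λ' := hmargin
    have hpoly : (2 + θ₁ / 8) ^ 2 < 4 * (1 + θ₁) := by nlinarith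
    have h0 : 0 < ω ^ 2 * rp ^ 2 := by positivity
    calc ω ^ 2 * (r + rp) ^ 2 ≤ ω ^ 2 * ((2 + θ₁ / 8) ^ 2 * rp ^ 2) := by gcongr
      _ = (2 + θ₁ / 8) ^ 2 * (ω ^ 2 * rp ^ 2) := by ring
      _ < 4 * (1 + θ₁) * (ω ^ 2 * rp ^ 2) := mul_lt_mul_of_pos_right hpoly h0
      _ ≤ Λ' := hω
  -- the split `K = Aσ + B`, `B = ω(r − rp)(r + rp)`, `B² ≤ Δω²(r + rp)²`
  have hKsplit := radialK_eq_horizon_add hM haM ω m r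
  set A := rp ^ 2 + a ^ 2 with hAdef
  set B := ω * (r - rp) * (r + rp) with hBdef
  have hKAB : K = A * σ + B := by rw [hK, hKsplit]
  have hB2 : B ^ 2 ≤ delta M a r * (ω ^ 2 * (r + rp) ^ 2) := by
    have e := sq_omega_mul_eq_delta_mul (ω := ω) ha hr
    rw [← hBdef] at e
    rw [e]
    have hsub : IsSubextremal M a := ha
    have hrm : 0 < r - rMinus M a := by linarith [hsub.rMinus_lt_rPlus]
    have hh : (r - rp) / (r - rMinus M a) ≤ 1 := by
      rw [div_le_one hrm]; linarith [hsub.rMinus_lt_rPlus]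
    have h0 : 0 ≤ delta M a r * (ω ^ 2 * (r + rp) ^ 2) := by positivity
    calc delta M a r * (ω ^ 2 * (r + rPlus M a) ^ 2 * ((r - rPlus M a) / (r - rMinus M a)))
        = delta M a r * (ω ^ 2 * (r + rp) ^ 2) * ((r - rp) / (r - rMinus M a)) := by rw [hrp]; ring
      _ ≤ delta M a r * (ω ^ 2 * (r + rp) ^ 2) * 1 := mul_le_mul_of_nonneg_left hh h0
      _ = _ := mul_one _
  have hB2lt : B ^ 2 < delta M a r * Λ' := lt_of_le_of_lt hB2 (mul_lt_mul_of_pos_left hωΛ hΔ)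
  -- superradiance: `Aσω < 0`
  have hApos : 0 < A := by positivity
  have hAσω : A * σ * ω < 0 := by
    have : A * (ω * σ) < 0 := mul_neg_of_pos_of_neg hApos hωσ
    linarith [show A * σ * ω = A * (ω * σ) by ring]
  -- if `Kω ≥ 0` then `K² ≤ B²`, contradiction
  by_contra hcon
  push Not at hcon
  have hBω : 0 ≤ B * ω := by
    have : K * ω = A * σ * ω + B * ω := by rw [hKAB]; ring
    linarith
  have hKω_le : K * ω ≤ B * ω := by
    have : K * ω = A * σ * ω + B * ω := by rw [hKAB]; ring
    linarith
  have hsq : (K * ω) ^ 2 ≤ (B * ω) ^ 2 := pow_le_pow_left₀ hcon hKω_le 2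
  have hK2le : K ^ 2 ≤ B ^ 2 := by
    rw [mul_pow, mul_pow] at hsq
    exact le_of_mul_le_mul_right hsq hω2
  linarith

end Algebra

section Derivative

variable {M a ω Λ : ℝ} {m : ℤ}

set_option maxHeartbeats 400000 in
-- two expressions for the derivative of `F = (r² + a²)²(ω² − V)` are compared
/-- **The potential is non-decreasing on the cap.** Under the hypotheses of `radialK_mul_lt_zero_of_cap`
and `Λ′ ≥ 100`: `0 ≤ dV/dr(r)`. [folklore] -/
theorem deriv_sepPotential_nonneg_of_cap (ha : |a| < M) {θ₁ : ℝ} (hθ₁ : 0 < θ₁) (hθ₁1 : θ₁ ≤ 1)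
    (hmargin : (1 + θ₁) * (2 * rPlus M a * ω) ^ 2 ≤ Λ - 2 * a * m * ω)
    (hωσ : ω * (ω - m * horizonAngularVelocity M a) < 0)
    (hΛ' : 100 ≤ Λ - 2 * a * m * ω)
    {r : ℝ} (hr : rPlus M a < r) (hr2 : r ≤ rPlus M a * (1 + θ₁ / 8))
    (hcap : sepPotential M a ω m Λ r ≤ ω ^ 2) :
    0 ≤ deriv (sepPotential M a ω m Λ) r := by
  have hM : 0 < M := lt_of_le_of_lt (abs_nonneg a) ha
  have haM : |a| ≤ M := ha.le
  set rp := rPlus M a with hrp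
  set Λ' := Λ - 2 * a * m * ω with hΛ'def
  have hrpM : M ≤ rp := M_le_rPlus M a
  have hrp2 : rp ≤ 2 * M := rPlus_le_two_mul_self hM.le a
  have hrp0 : 0 < rp := rPlus_pos hM a
  have hr0 : 0 < r := hrp0.trans hr
  have hMr : M ≤ r := hrpM.trans hr.le
  set A := r ^ 2 + a ^ 2 with hAdef
  have hApos : 0 < A := by positivity
  have hA : A ≠ 0 := hApos.ne'
  -- `V′ = v`
  have hV := hasDerivAt_sepPotential M a ω m Λ (r := r) hA
  set v := critPoly M a ω m Λ r / (r ^ 2 + a ^ 2) ^ 3 + critPoly₁ M a r / (r ^ 2 + a ^ 2) ^ 5 with hv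
  rw [hV.deriv]
  -- first expression: `F′ = 4rA(ω² − V) − A²v`
  have hsq : HasDerivAt (fun s : ℝ ↦ (s ^ 2 + a ^ 2) ^ 2) (2 * (r ^ 2 + a ^ 2) * (2 * r)) r := by
    have h1 : HasDerivAt (fun s : ℝ ↦ s ^ 2 + a ^ 2) (2 * r) r := by
      simpa using (hasDerivAt_pow 2 r).add_const (a ^ 2)
    refine (h1.fun_pow 2).congr_deriv ?_
    norm_num
  have hF₁ : HasDerivAt (fun s : ℝ ↦ (s ^ 2 + a ^ 2) ^ 2 * (ω ^ 2 - sepPotential M a ω m Λ s))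
      (2 * (r ^ 2 + a ^ 2) * (2 * r) * (ω ^ 2 - sepPotential M a ω m Λ r) +
        (r ^ 2 + a ^ 2) ^ 2 * (0 - v)) r :=
    hsq.mul ((hasDerivAt_const r (ω ^ 2)).sub hV)
  -- second expression: `F = K² − ΔΛ′ − A²V₁`
  have hK : HasDerivAt (fun s : ℝ ↦ radialK a ω m s) (ω * (2 * r)) r := by
    have h1 : HasDerivAt (fun s : ℝ ↦ s ^ 2 + a ^ 2) (2 * r) r := by
      simpa using (hasDerivAt_pow 2 r).add_const (a ^ 2)
    have h2 := (h1.const_mul ω).sub_const (a * (m : ℝ))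
    refine h2.congr_of_eventuallyEq (Filter.Eventually.of_forall fun s ↦ ?_)
    simp [radialK]
  have hK2 : HasDerivAt (fun s : ℝ ↦ radialK a ω m s ^ 2) (2 * radialK a ω m r * (ω * (2 * r))) r := by
    refine (hK.fun_pow 2).congr_deriv ?_
    norm_num
  have hΔd : HasDerivAt (fun s : ℝ ↦ delta M a s * Λ') (2 * (r - M) * Λ') r :=
    (hasDerivAt_delta M a r).mul_const Λ'
  have hV₁ := hasDerivAt_sepPotential₁ M a (r := r) hA
  have hW₁ : HasDerivAt (fun s : ℝ ↦ (s ^ 2 + a ^ 2) ^ 2 * sepPotential₁ M a s)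
      (2 * (r ^ 2 + a ^ 2) * (2 * r) * sepPotential₁ M a r +
        (r ^ 2 + a ^ 2) ^ 2 * (critPoly₁ M a r / (r ^ 2 + a ^ 2) ^ 5)) r := hsq.mul hV₁
  have hF₂ : HasDerivAt
      (fun s : ℝ ↦ radialK a ω m s ^ 2 - delta M a s * Λ' - (s ^ 2 + a ^ 2) ^ 2 * sepPotential₁ M a s)
      (2 * radialK a ω m r * (ω * (2 * r)) - 2 * (r - M) * Λ' -
        (2 * (r ^ 2 + a ^ 2) * (2 * r) * sepPotential₁ M a r +
          (r ^ 2 + a ^ 2) ^ 2 * (critPoly₁ M a r / (r ^ 2 + a ^ 2) ^ 5))) r :=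
    (hK2.sub hΔd).sub hW₁
  -- the two functions agree near `r` (`s > 0`)
  have heq : (fun s : ℝ ↦ radialK a ω m s ^ 2 - delta M a s * Λ' - (s ^ 2 + a ^ 2) ^ 2 * sepPotential₁ M a s)
      =ᶠ[𝓝 r] (fun s : ℝ ↦ (s ^ 2 + a ^ 2) ^ 2 * (ω ^ 2 - sepPotential M a ω m Λ s)) := by
    filter_upwards [Ioi_mem_nhds hr0] with s hs
    have hsA : s ^ 2 + a ^ 2 ≠ 0 := by
      have : (0 : ℝ) < s := hs
      positivity
    exact (sq_mul_coeff_eq M a ω m Λ hsA).symm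
  have hF₂' := hF₂.congr_of_eventuallyEq heq.symm
  have hderiv := hF₁.unique hF₂'
  -- signs of the pieces
  have hKω : radialK a ω m r * ω < 0 := radialK_mul_lt_zero_of_cap ha hθ₁ hθ₁1 hmargin hωσ hr hr2 hcap
  have hΔ0 : 0 ≤ delta M a r := delta_nonneg haM hr.le
  have hr94 : r ≤ 9 * M / 4 := by
    have : rp * (1 + θ₁ / 8) ≤ (2 * M) * (9 / 8) :=
      mul_le_mul hrp2 (by linarith) (by positivity) (by positivity)
    linarith
  have hP₁ := critPoly₁_ge_neg hM haM hMr hr94 hΔ0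
  have hV₁0 : 0 ≤ sepPotential₁ M a r := sepPotential₁_nonneg haM hr.le
  have hcap' : 0 ≤ ω ^ 2 - sepPotential M a ω m Λ r := by linarith
  -- `A ≥ M²`, so `critPoly₁/A³ ≥ −344ΔM⁵/M⁶ = −344Δ/M`
  have hA1 : M ^ 2 ≤ A := by
    have : M ^ 2 ≤ r ^ 2 := pow_le_pow_left₀ hM.le hMr 2
    have := sq_nonneg a
    rw [hAdef]; linarith
  have hA3 : M ^ 6 ≤ A ^ 3 := by
    have := pow_le_pow_left₀ (by positivity) hA1 3
    have e : (M ^ 2) ^ 3 = M ^ 6 := by ring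
    rwa [e] at this
  have hcrit : -(344 / M) * delta M a r ≤ critPoly₁ M a r / A ^ 3 := by
    rw [le_div_iff₀ (by positivity)]
    -- `−(344/M)Δ·A³ ≤ −(344/M)Δ·M⁶ = −344M⁵Δ ≤ P₁`
    have h2 : -(344 / M) * delta M a r * A ^ 3 ≤ -(344 / M) * delta M a r * M ^ 6 := by
      have hneg : -(344 / M) * delta M a r ≤ 0 := by
        have : 0 ≤ 344 / M * delta M a r := by positivity
        linarith
      exact mul_le_mul_of_nonpos_left hA3 hneg
    have e : -(344 / M) * delta M a r * M ^ 6 = -(344 * M ^ 5) * delta M a r := by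
      field_simp
    linarith
  -- `2(r − M)Λ′ − (344/M)Δ ≥ 0`: `2(r − M) = (r − rp) + (r − r₋)`, `Δ = (r − rp)(r − r₋)`, `r − rp ≤ M/4`
  have hsum : rp + rMinus M a = 2 * M := by rw [hrp]; unfold rPlus rMinus; ring
  have hrm : 0 < r - rMinus M a := by
    have hsub : IsSubextremal M a := ha
    linarith [hsub.rMinus_lt_rPlus]
  have hmain : 0 ≤ 2 * (r - M) * Λ' - 344 / M * delta M a r := by
    rw [delta_eq_mul haM r]
    have h1 : r - rp ≤ M / 4 := by
      have : rp * (1 + θ₁ / 8) ≤ rp + (2 * M) * (1 / 8) := by nlinarith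
      linarith
    have h2 : 0 ≤ r - rp := by linarith
    have h3 : 344 / M * ((r - rPlus M a) * (r - rMinus M a)) ≤ 86 * (r - rMinus M a) := by
      rw [← hrp]
      have : 344 / M * (r - rp) ≤ 86 := by
        rw [div_mul_eq_mul_div, div_le_iff₀ hM]; linarith
      calc 344 / M * ((r - rp) * (r - rMinus M a)) = (344 / M * (r - rp)) * (r - rMinus M a) := by ring
        _ ≤ 86 * (r - rMinus M a) := mul_le_mul_of_nonneg_right this hrm.le
    have h4 : (r - rMinus M a) * Λ' ≤ 2 * (r - M) * Λ' := by
      have e : 2 * (r - M) = (r - rp) + (r - rMinus M a) := by linarith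
      rw [e]
      apply mul_le_mul_of_nonneg_right _ (by linarith)
      linarith
    have h5 : 100 * (r - rMinus M a) ≤ (r - rMinus M a) * Λ' := by
      rw [mul_comm]; exact mul_le_mul_of_nonneg_left hΛ' hrm.le
    linarith
  -- assemble: `A²v = 4rA(ω² − V) − 4rKω + 2(r − M)Λ′ + W₁′`
  have hkey : (r ^ 2 + a ^ 2) ^ 2 * v =
      2 * (r ^ 2 + a ^ 2) * (2 * r) * (ω ^ 2 - sepPotential M a ω m Λ r) -
        (2 * radialK a ω m r * (ω * (2 * r)) - 2 * (r - M) * Λ' -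
          (2 * (r ^ 2 + a ^ 2) * (2 * r) * sepPotential₁ M a r +
            (r ^ 2 + a ^ 2) ^ 2 * (critPoly₁ M a r / (r ^ 2 + a ^ 2) ^ 5))) := by
    linarith [hderiv]
  have hW₁d : -(344 / M) * delta M a r ≤ 2 * (r ^ 2 + a ^ 2) * (2 * r) * sepPotential₁ M a r +
      (r ^ 2 + a ^ 2) ^ 2 * (critPoly₁ M a r / (r ^ 2 + a ^ 2) ^ 5) := by
    have h1 : 0 ≤ 2 * (r ^ 2 + a ^ 2) * (2 * r) * sepPotential₁ M a r := by positivity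
    have e : (r ^ 2 + a ^ 2) ^ 2 * (critPoly₁ M a r / (r ^ 2 + a ^ 2) ^ 5) = critPoly₁ M a r / A ^ 3 := by
      rw [hAdef]; field_simp
    rw [e]
    linarith [hcrit]
  have hKterm : 2 * radialK a ω m r * (ω * (2 * r)) ≤ 0 := by
    have : 2 * radialK a ω m r * (ω * (2 * r)) = 4 * r * (radialK a ω m r * ω) := by ring
    rw [this]
    exact mul_nonpos_of_nonneg_of_nonpos (by positivity) hKω.le
  have hfirst : 0 ≤ 2 * (r ^ 2 + a ^ 2) * (2 * r) * (ω ^ 2 - sepPotential M a ω m Λ r) := by positivity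
  have hA2v : 0 ≤ (r ^ 2 + a ^ 2) ^ 2 * v := by
    rw [hkey]
    linarith
  have hA2 : 0 < (r ^ 2 + a ^ 2) ^ 2 := by positivity
  by_contra hcon
  push Not at hcon
  have : (r ^ 2 + a ^ 2) ^ 2 * v < 0 := mul_neg_of_pos_of_neg hA2 hcon
  linarith

end Derivative

section Sonin

variable {M a ω Λ : ℝ} {m : ℤ} {ρ : ℝ → ℝ} {u u₁ : ℝ → ℂ}

/-- **Sharp Sonin bound on the cap for the `𝓗⁺`-data solution.** Along a tortoise radius of a sub-extremal
exterior, in the superradiant BF-stable regime (`0 < θ₁ ≤ 1`, margin, `ωσ < 0`, `Λ′ ≥ 100`), let `b` be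
such that `ω² − V(ρ s) ≥ 0` for `s ≤ b` and `ρ b ≤ r₊(1 + θ₁/8)`. Then the solution with horizon data
`‖u‖ → 1`, `‖u′‖ → |σ|` satisfies `(ω² − V(ρ s))‖u s‖² + ‖u′ s‖² ≤ 2σ²` for every `s ≤ b`; in
particular `‖u′ s‖² ≤ 2σ²` there. [folklore] -/
theorem carter_cap_soninEnergy_le (hρ : IsTortoiseRadius M a ρ) (hMa : IsSubextremal M a)
    {θ₁ : ℝ} (hθ₁ : 0 < θ₁) (hθ₁1 : θ₁ ≤ 1)
    (hmargin : (1 + θ₁) * (2 * rPlus M a * ω) ^ 2 ≤ Λ - 2 * a * m * ω)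
    (hωσ : ω * (ω - m * horizonAngularVelocity M a) < 0)
    (hΛ' : 100 ≤ Λ - 2 * a * m * ω)
    (hu : ∀ x, HasDerivAt u (u₁ x) x ∧
      HasDerivAt u₁ (-(((ω ^ 2 - sepPotential M a ω m Λ (ρ x) : ℝ) : ℂ) * u x)) x)
    (hlim : Tendsto (fun x ↦ ‖u x‖) atBot (𝓝 1))
    (hlim₁ : Tendsto (fun x ↦ ‖u₁ x‖) atBot (𝓝 |ω - m * horizonAngularVelocity M a|))
    {b : ℝ} (hcap : ∀ s, s ≤ b → 0 ≤ ω ^ 2 - sepPotential M a ω m Λ (ρ s))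
    (hb : ρ b ≤ rPlus M a * (1 + θ₁ / 8)) {s : ℝ} (hs : s ≤ b) :
    (ω ^ 2 - sepPotential M a ω m Λ (ρ s)) * ‖u s‖ ^ 2 + ‖u₁ s‖ ^ 2 ≤
        2 * (ω - m * horizonAngularVelocity M a) ^ 2 ∧
      ‖u₁ s‖ ^ 2 ≤ 2 * (ω - m * horizonAngularVelocity M a) ^ 2 := by
  have ha : |a| < M := hMa
  set φ : ℝ → ℝ := fun y ↦ ω ^ 2 - sepPotential M a ω m Λ (ρ y) with hφ
  set φ' : ℝ → ℝ := fun y ↦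
    -(deriv (sepPotential M a ω m Λ) (ρ y) * (delta M a (ρ y) / (ρ y ^ 2 + a ^ 2))) with hφ'
  have hφd : ∀ y, y ≤ b → HasDerivAt φ (φ' y) y := fun y _ ↦
    hρ.hasDerivAt_omega_sq_sub_sepPotential hMa ω m Λ y
  have hφ'le : ∀ y, y ≤ b → φ' y ≤ 0 := by
    intro y hy
    have hry : ρ y ≤ rPlus M a * (1 + θ₁ / 8) := le_trans ((hρ.strictMono hMa).monotone hy) hb
    have hcapy : sepPotential M a ω m Λ (ρ y) ≤ ω ^ 2 := by linarith [hcap y hy]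
    have hV' := deriv_sepPotential_nonneg_of_cap ha hθ₁ hθ₁1 hmargin hωσ hΛ' (hρ.rPlus_lt y) hry hcapy
    have hρ' : 0 ≤ delta M a (ρ y) / (ρ y ^ 2 + a ^ 2) := (hρ.deriv_pos hMa y).le
    show -(deriv (sepPotential M a ω m Λ) (ρ y) * (delta M a (ρ y) / (ρ y ^ 2 + a ^ 2))) ≤ 0
    have := mul_nonneg hV' hρ'
    linarith
  have hφlim : Tendsto φ atBot (𝓝 ((ω - m * horizonAngularVelocity M a) ^ 2)) :=
    hρ.tendsto_coeff_atBot hMa ω m Λ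
  obtain ⟨h1, h2, -⟩ := soninEnergy_le_two_mul_sq_of_horizon_data (φ := φ) (φ' := φ') hu hφd hφ'le hlim
    hlim₁ hφlim hs
  exact ⟨h1, h2 (hcap s hs)⟩

end Sonin

end Kerr

end Literature.Geometry.Lorentzian

end
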